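import Summits.BirchSwinnertonDyer.BirchSwinnertonDyer.Theorems.EisensteinPrimesBSDpOnCellCTelescopeK2InertiaDefect
import Summits.BirchSwinnertonDyer.BirchSwinnertonDyer.Theorems.ErratumRoadFiveBigRepInvariantsShift
import Mathlib.Algebra.Polynomial.AlgebraMap
import HarnessLib

/-!
# Crux 4 `BSDpOnCellC` (stmt-BirchSwinnertonDyer-19034), line `telescope`, leaf N2 `stub_weightTwoControl` (W2) / N3′: the
# ANNIHILATOR of the shifted-Frobenius-fixed part — if `P(ρ(d₀))` kills `A^{I}/c·A^{I}` and `κ(d₀) = N`, then `P((1+T)^N) ∈ 𝒪⟦T⟧`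
# multiplies every `D`-fixed-mod-`c` invariant function into `(C c) • (M|_I)^I`: the refined `hkill` of
# `TelescopeK2RefinedLocalDefect.smul_mem_map_torsionInclH1_selmer_of_factor` at a ramified inertia index, DISCHARGED from an
# annihilating polynomial (repair (R2) of memo #52, value side; helper, `--supports stmt-BirchSwinnertonDyer-19034 --as helper`; closes nothing)

Cell `bsd-eis`, width seat `bsd-line-x2-p2` (prover g19, 2026-08-29; D-0154 KEY row 5). THEOREMS ONLY: no definition, no named
fact, no `sorry`, no instance, no notation. Elementary: on the co-induced module `C^∞(ℤ_p, A)` (`BigRepModule 𝒪 p A`, `T` acting as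
`τ₁ − 1`, tree `InvariantsShift.one_add_X_pow_smul_apply`: `(1+T)^N` is translation by `N`), a polynomial in `(1+T)^N` acts on a
function which is «fixed by the shifted endomorphism `Φ ↦ F(Φ(· − N))` modulo a submodule `S`» as the same polynomial in `F` on the
values, modulo `S` (GV00 Prop. 2.4's mechanism, elementwise; no Mahler transform, no cofreeness).

* §1 `pow_sub_apply_add_mem` — if `F(Φ x) − Φ(x + N) ∈ S` for all `x` and `F(S) ⊆ S`, then `F^i(Φ x) − Φ(x + iN) ∈ S`;
  **`aeval_smul_apply_sub_aeval_apply_mem`** — `(P((1+T)^N) • Φ)(x) − P(F)(Φ x) ∈ S` for every `P ∈ 𝒪[Y]`;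
  **`aeval_smul_apply_mem`** — hence `(P((1+T)^N) • Φ)(x) ∈ S` whenever `P(F)(Φ x) ∈ S` for all `x`.
* §2 **`exists_C_smul_eq_aeval_smul_invariants_restrict`** — THE REFINED `hkill` AT AN INERTIA-TYPE INDEX of `M = bigRep κ ρ`:
  along `φI : I → G` (`κ ∘ φI = 1`) with a `d₀ : D`, `ψ : D → G`, `κ(ψ d₀) = N ∈ ℕ`, `ψ(d₀)` normalising `φI(I)`: if
  `P(ρ(ψ d₀)) a ∈ c • A^{φI(I)}` for every `a ∈ A^{φI(I)}` and the `p`-primary elements of `c • A^{φI(I)}` have `p`-primary `c`-roots IN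
  `A^{φI(I)}`, then for every invariant `Φ ∈ (M|_I)^I` with `ρ_M(ψ d₀) Φ − Φ ∈ (C c) • (M|_I)^I` there is `Φ' ∈ (M|_I)^I` with
  `(C c) • Φ' = P((1+T)^N) • Φ` — i.e. the hypothesis `hkill` of `…RefinedLocalDefect.smul_mem_map_torsionInclH1_selmer_of_factor`
  at that index with `s = aeval ((1+X)^N) P` (for `P` monic, `s ∉ (C X)` in `ℤ_p⟦X⟧⟦T⟧`).

HONEST FRAMING: elementary algebra over binders; the arithmetic inputs at a ramified `w ∣ N` of the branch — an annihilating polynomial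
of `Frob_w` on `A₂^{I_w}/X·A₂^{I_w}` (e.g. through `A₂^{I_w}/X ↪ H¹(I_w, A₂[X]) ≈ H¹(I_w, E[p^∞])` and Cayley–Hamilton on `T_pE`) and
the finite decomposition of `w` in `K_∞` (a `d₀ ∈ D_w` with `κ(d₀) = p^s`) — are NOT proved here; nothing about any curve is asserted;
BSD is proved for no pair; no registered stub, crux or summit statement is proved by this file; closes: none.

References: [GreenbergVatsal2000] Prop. 2.4 (arXiv:math/9906215 p. 22: `𝓟_ℓ = P_ℓ(ℓ⁻¹γ_ℓ)` generates the characteristic ideal of the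
local condition at a finitely decomposed `ℓ`); [JetchevSkinnerWan2017] §3.4 Lemma 3.4.1; [Ochiai2006] Prop. 5.1 (Compositio 142 p. 1177).
-/

noncomputable section

-- D-0017: single-problem summit, the namespace repeats the problem name by design.
set_option linter.dupNamespace false
set_option autoImplicit false

open scoped Pointwise
open Polynomial hiding X C
open Literature.NumberTheory.GaloisRepresentations Literature.NumberTheory.EllipticCurves
  Literature.NumberTheory.EllipticCurves.BigRepModule
open Summit.BirchSwinnertonDyer.BirchSwinnertonDyer.Theorems.ErratumThm23TwoVariable

namespace Summit.BirchSwinnertonDyer.BirchSwinnertonDyer.Theorems.TelescopeK2TwistedFixedAnnihilator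

/-! ## §1 A polynomial in `(1+T)^N` acts as the polynomial in `F` on shifted-fixed functions, modulo `S` -/

section Shift

variable {𝒪 : Type*} [CommRing 𝒪] {p : ℕ} [Fact p.Prime] {A : Type*} [AddCommGroup A] [Module 𝒪 A]
  (F : A →ₗ[𝒪] A) (S : Submodule 𝒪 A) (N : ℕ) (Φ : BigRepModule 𝒪 p A)

/-- `F^i(Φ x) − Φ(x + iN) ∈ S` from `F(Φ x) − Φ(x + N) ∈ S` and `F(S) ⊆ S`. [cite: GreenbergVatsal2000, Prop. 2.4 (proof)] [folklore] -/
theorem pow_sub_apply_add_mem (hS : ∀ a ∈ S, F a ∈ S) (hfix : ∀ x : ℤ_[p], F (Φ x) - Φ (x + N) ∈ S) (i : ℕ) (x : ℤ_[p]) :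
    (F ^ i) (Φ x) - Φ (x + (i * N : ℕ)) ∈ S := by
  induction i generalizing x with
  | zero => simp
  | succ i ih =>
    have h1 : (F ^ (i + 1)) (Φ x) - F (Φ (x + (i * N : ℕ))) ∈ S := by
      rw [pow_succ', Module.End.mul_apply, ← map_sub]
      exact hS _ (ih x)
    have h2 : F (Φ (x + (i * N : ℕ))) - Φ (x + ((i + 1) * N : ℕ)) ∈ S := by
      have := hfix (x + (i * N : ℕ))
      rwa [add_assoc, ← Nat.cast_add, ← Nat.succ_mul] at this
    have := S.add_mem h1 h2
    rwa [sub_add_sub_cancel] at this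

/-- **`(P((1+T)^N) • Φ)(x) − P(F)(Φ x) ∈ S`** for every polynomial `P`, when `Φ` is fixed by the shifted `F` modulo the `F`-stable `S`.
[cite: GreenbergVatsal2000, Prop. 2.4 (proof: the eigenvalues of γ_ℓ on the local term)] [folklore] -/
theorem aeval_smul_apply_sub_aeval_apply_mem (hS : ∀ a ∈ S, F a ∈ S) (hfix : ∀ x : ℤ_[p], F (Φ x) - Φ (x + N) ∈ S)
    (P : 𝒪[X]) (x : ℤ_[p]) :
    ((Polynomial.aeval (((1 : PowerSeries 𝒪) + PowerSeries.X) ^ N) P : PowerSeries 𝒪) • Φ) x -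
      (Polynomial.aeval F P) (Φ x) ∈ S := by
  induction P using Polynomial.induction_on' with
  | add P Q hP hQ =>
    rw [map_add, map_add, add_smul, BigRepModule.add_apply, LinearMap.add_apply]
    have := S.add_mem hP hQ
    rwa [sub_add_sub_comm] at this
  | monomial i a =>
    rw [Polynomial.aeval_monomial, Polynomial.aeval_monomial]
    -- `algebraMap 𝒪 𝒪⟦T⟧ a = C a`, `algebraMap 𝒪 (End A) a = a • 1`
    have h1 : ((algebraMap 𝒪 (PowerSeries 𝒪) a * (((1 : PowerSeries 𝒪) + PowerSeries.X) ^ N) ^ i) • Φ) x =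
        a • Φ (x + (i * N : ℕ)) := by
      rw [mul_smul, show algebraMap 𝒪 (PowerSeries 𝒪) a = PowerSeries.C a from rfl, C_smul,
        BigRepModule.smul_apply, ← pow_mul, InvariantsShift.one_add_X_pow_smul_apply, mul_comm N i]
    have h2 : (algebraMap 𝒪 (Module.End 𝒪 A) a * F ^ i) (Φ x) = a • (F ^ i) (Φ x) := by
      rw [Module.End.mul_apply, Module.algebraMap_end_apply]
    rw [h1, h2, ← smul_sub]
    exact S.smul_mem a (by
      have := pow_sub_apply_add_mem F S N Φ hS hfix i x
      rw [← neg_sub] at this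
      -- `Φ(x + iN) − F^i (Φ x) ∈ S`
      have h3 := S.neg_mem (pow_sub_apply_add_mem F S N Φ hS hfix i x)
      rwa [neg_sub] at h3)

/-- **`(P((1+T)^N) • Φ)(x) ∈ S`** whenever `P(F)(Φ x) ∈ S` for all `x` (and `Φ` is shifted-`F`-fixed modulo the `F`-stable `S`):
the ANNIHILATOR of the twisted-fixed part modulo `S` (GV00's `𝓟_ℓ = P_ℓ(γ_ℓ)` acting by zero).
[cite: GreenbergVatsal2000, Prop. 2.4 (arXiv:math/9906215 p. 22)] [folklore] -/
theorem aeval_smul_apply_mem (hS : ∀ a ∈ S, F a ∈ S) (hfix : ∀ x : ℤ_[p], F (Φ x) - Φ (x + N) ∈ S)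
    (P : 𝒪[X]) (hP : ∀ x : ℤ_[p], (Polynomial.aeval F P) (Φ x) ∈ S) (x : ℤ_[p]) :
    ((Polynomial.aeval (((1 : PowerSeries 𝒪) + PowerSeries.X) ^ N) P : PowerSeries 𝒪) • Φ) x ∈ S := by
  have := S.add_mem (aeval_smul_apply_sub_aeval_apply_mem F S N Φ hS hfix P x) (hP x)
  rwa [sub_add_cancel] at this

end Shift

/-! ## §2 The refined `hkill` at an inertia-type index of `M = bigRep κ ρ` from an annihilating polynomial -/

section BigRep

variable {𝒪 : Type*} [CommRing 𝒪] [TopologicalSpace 𝒪] {p : ℕ} [Fact p.Prime]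
  {A : Type*} [AddCommGroup A] [Module 𝒪 A] [TopologicalSpace A] [DiscreteTopology A]
  {G : Type*} [Group G] [TopologicalSpace G] [ContinuousMul G]
  {H : Type*} [Group H] [TopologicalSpace H]
  (κ : G →ₜ* Multiplicative ℤ_[p]) (ρ : ContinuousRep G 𝒪 A) [TopologicalSpace (PowerSeries 𝒪)]
  [ContinuousSMul (PowerSeries 𝒪) (BigRepModule 𝒪 p A)] (φ : H →ₜ* G)

/-- **THE REFINED `hkill` AT AN INERTIA-TYPE INDEX, DISCHARGED FROM AN ANNIHILATING POLYNOMIAL.** Along `φ : H → G` with `κ ∘ φ = 1`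
(an inertia group at a ramified `w ∤ p`), let `g₀ ∈ G` normalise `φ(H)` (`∀ h, ∃ h₀, φ h₀ = g₀⁻¹ (φ h) g₀`: a Frobenius of `D_w ⊇ I_w`)
with `κ g₀ = N ∈ ℕ` (`w` finitely decomposed in `K_∞`), `c ∈ 𝒪` (`c = X`), `P ∈ 𝒪[Y]` with `P(ρ g₀) a ∈ c • A^{φ(H)}` for every
`a ∈ A^{φ(H)}` (an annihilating polynomial of `Frob_w` on `A^{I_w}/c`), and suppose the `p`-primary elements of `c • A^{φ(H)}` have
`p`-primary `c`-roots in `A^{φ(H)}`. Then every invariant `Φ ∈ (M|_H)^H` with `ρ_M(g₀) Φ − Φ ∈ (C c) • (M|_H)^H` admits `Φ' ∈ (M|_H)^H`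
with `(C c) • Φ' = P((1+T)^N) • Φ` — the hypothesis `hkill` of
`TelescopeK2RefinedLocalDefect.smul_mem_map_torsionInclH1_selmer_of_factor` at this index, `s = aeval ((1+X)^N) P`.
[cite: GreenbergVatsal2000, Prop. 2.4 (arXiv:math/9906215 p. 22)] [cite: JetchevSkinnerWan2017, §3.4, Lemma 3.4.1]
[cite: Ochiai2006, Prop. 5.1 (Compositio 142 p. 1177)] -/
theorem exists_C_smul_eq_aeval_smul_invariants_restrict (hκ : ∀ h : H, κ (φ h) = 1) (g₀ : G)
    (hnormal : ∀ h : H, ∃ h₀ : H, φ h₀ = g₀⁻¹ * φ h * g₀) {N : ℕ} (hN : (κ g₀).toAdd = (N : ℤ_[p]))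
    (c : 𝒪) (P : 𝒪[X])
    (hP : ∀ a : A, (∀ h : H, ρ (φ h) a = a) → ∃ a₀ : A, (∀ h : H, ρ (φ h) a₀ = a₀) ∧ c • a₀ = (Polynomial.aeval (ρ g₀) P) a)
    (hroots : ∀ a : A, (∀ h : H, ρ (φ h) a = a) → (∃ k : ℕ, p ^ k • a = 0) →
      (∃ a₀ : A, (∀ h : H, ρ (φ h) a₀ = a₀) ∧ c • a₀ = a) →
      ∃ b : A, (∀ h : H, ρ (φ h) b = b) ∧ (∃ k : ℕ, p ^ k • b = 0) ∧ c • b = a)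
    (Φ : BigRepModule 𝒪 p A) (hΦ : Φ ∈ (((bigRep (p := p) κ ρ).restrict φ).toTopRep).ρ.invariants)
    (hfix : bigRep (p := p) κ ρ g₀ Φ - Φ ∈
      (PowerSeries.C c : PowerSeries 𝒪) • (((bigRep (p := p) κ ρ).restrict φ).toTopRep).ρ.invariants) :
    ∃ Φ' ∈ (((bigRep (p := p) κ ρ).restrict φ).toTopRep).ρ.invariants,
      (PowerSeries.C c : PowerSeries 𝒪) • Φ' =
        (Polynomial.aeval (((1 : PowerSeries 𝒪) + PowerSeries.X) ^ N) P : PowerSeries 𝒪) • Φ := by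
  classical
  -- the fixed submodule `A^{φ(H)}` and `S = c • A^{φ(H)}`
  let AI : Submodule 𝒪 A :=
    { carrier := {a | ∀ h : H, ρ (φ h) a = a}
      zero_mem' := fun h => map_zero _
      add_mem' := fun {a b} ha hb h => by rw [map_add, ha h, hb h]
      smul_mem' := fun r {a} ha h => by rw [map_smul, ha h] }
  have hAI : ∀ a : A, a ∈ AI ↔ ∀ h : H, ρ (φ h) a = a := fun a => Iff.rfl
  let S : Submodule 𝒪 A := c • AI
  have hSmem : ∀ a : A, a ∈ S ↔ ∃ a₀ : A, (∀ h : H, ρ (φ h) a₀ = a₀) ∧ c • a₀ = a := fun a => by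
    change a ∈ c • AI ↔ _
    rw [Submodule.mem_smul_pointwise_iff_exists]
    exact ⟨fun ⟨a₀, h0, e⟩ => ⟨a₀, (hAI a₀).1 h0, e⟩, fun ⟨a₀, h0, e⟩ => ⟨a₀, (hAI a₀).2 h0, e⟩⟩
  -- `ρ g₀` preserves `A^{φ(H)}` (normality), hence `S`
  have hg₀AI : ∀ a : A, (∀ h : H, ρ (φ h) a = a) → ∀ h : H, ρ (φ h) (ρ g₀ a) = ρ g₀ a := by
    intro a ha h
    obtain ⟨h₀, hh₀⟩ := hnormal h
    have : φ h * g₀ = g₀ * φ h₀ := by rw [hh₀, ← mul_assoc, ← mul_assoc, mul_inv_cancel, one_mul]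
    rw [← Module.End.mul_apply, ← _root_.map_mul, this, _root_.map_mul, Module.End.mul_apply, ha h₀]
  have hS : ∀ a ∈ S, (ρ g₀ : A →ₗ[𝒪] A) a ∈ S := by
    intro a ha
    obtain ⟨a₀, h0, rfl⟩ := (hSmem a).1 ha
    exact (hSmem _).2 ⟨ρ g₀ a₀, hg₀AI a₀ h0, by rw [map_smul]⟩
  -- the values of `Φ` are fixed; the shifted-fixedness modulo `S`
  have hΦval : ∀ x : ℤ_[p], ∀ h : H, ρ (φ h) (Φ x) = Φ x :=
    (TelescopeK2InertiaDefect.mem_invariants_restrict_iff_of_trivial κ ρ φ hκ Φ).1 hΦ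
  obtain ⟨Ψ, hΨ, hΨeq⟩ := (Submodule.mem_smul_pointwise_iff_exists _ _ _).1 hfix
  have hΨval : ∀ x : ℤ_[p], ∀ h : H, ρ (φ h) (Ψ x) = Ψ x :=
    (TelescopeK2InertiaDefect.mem_invariants_restrict_iff_of_trivial κ ρ φ hκ Ψ).1 hΨ
  have hfix' : ∀ x : ℤ_[p], (ρ g₀ : A →ₗ[𝒪] A) (Φ x) - Φ (x + N) ∈ S := by
    intro x
    have e := DFunLike.congr_fun hΨeq (x + N)
    rw [BigRepModule.sub_apply, bigRep_apply_apply, hN, add_sub_cancel_right, C_smul, BigRepModule.smul_apply] at e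
    -- e : ρ g₀ (Φ x) - Φ (x + N) = c • Ψ (x + N)
    exact (hSmem _).2 ⟨Ψ (x + N), hΨval _, e⟩
  have hPx : ∀ x : ℤ_[p], (Polynomial.aeval (ρ g₀ : A →ₗ[𝒪] A) P) (Φ x) ∈ S := fun x => by
    obtain ⟨a₀, h0, e⟩ := hP (Φ x) (hΦval x)
    exact (hSmem _).2 ⟨a₀, h0, e⟩
  -- the values of `s • Φ` lie in `S = c • A^{φ(H)}`
  have hval : ∀ x : ℤ_[p], ∃ b : A, (∀ h : H, ρ (φ h) b = b) ∧ (∃ k : ℕ, p ^ k • b = 0) ∧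
      c • b = ((Polynomial.aeval (((1 : PowerSeries 𝒪) + PowerSeries.X) ^ N) P : PowerSeries 𝒪) • Φ) x := by
    intro x
    have hmem := aeval_smul_apply_mem (ρ g₀ : A →ₗ[𝒪] A) S N Φ hS hfix' P hPx x
    obtain ⟨t, ht⟩ := (((Polynomial.aeval (((1 : PowerSeries 𝒪) + PowerSeries.X) ^ N) P : PowerSeries 𝒪) • Φ)).exists_torsion
    have hfixed : ∀ h : H, ρ (φ h) ((((Polynomial.aeval (((1 : PowerSeries 𝒪) + PowerSeries.X) ^ N) P : PowerSeries 𝒪) • Φ)) x) =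
        (((Polynomial.aeval (((1 : PowerSeries 𝒪) + PowerSeries.X) ^ N) P : PowerSeries 𝒪) • Φ)) x := by
      obtain ⟨a₀, h0, e⟩ := (hSmem _).1 hmem
      intro h
      rw [← e, map_smul, h0 h]
    exact hroots _ hfixed ⟨t, ht x⟩ ((hSmem _).1 hmem)
  -- pointwise section through the values (level of `s • Φ`, uniform `p`-exponent)
  set Θ := ((Polynomial.aeval (((1 : PowerSeries 𝒪) + PowerSeries.X) ^ N) P : PowerSeries 𝒪) • Φ) with hΘ
  obtain ⟨n, hn⟩ := Θ.exists_level
  set sec : A → A := fun a =>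
    if h : ∃ b : A, (∀ h : H, ρ (φ h) b = b) ∧ (∃ k : ℕ, p ^ k • b = 0) ∧ c • b = a then Classical.choose h else 0
    with hsec_def
  have hsec : ∀ x : ℤ_[p], (∀ h : H, ρ (φ h) (sec (Θ x)) = sec (Θ x)) ∧ (∃ k : ℕ, p ^ k • sec (Θ x) = 0) ∧
      c • sec (Θ x) = Θ x := by
    intro x
    rw [hsec_def]
    simp only [dif_pos (hval x)]
    exact Classical.choose_spec (hval x)
  choose kA hkA using fun x : ℤ_[p] => (hsec x).2.1
  let Φ' : BigRepModule 𝒪 p A := BigRepModule.mk (fun x => sec (Θ x))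
    ⟨⟨n, fun x y hxy => congrArg sec (hn x y hxy)⟩, ⟨(Finset.range (p ^ n)).sup (fun i : ℕ => kA (i : ℤ_[p])), fun x => by
      have hx : Θ x = Θ ((x.appr n : ℕ) : ℤ_[p]) := hn _ _ (PadicInt.appr_spec n x)
      change p ^ _ • sec (Θ x) = 0
      rw [hx]
      have hi : x.appr n ∈ Finset.range (p ^ n) := Finset.mem_range.mpr (PadicInt.appr_lt x n)
      obtain ⟨e, he⟩ := Nat.exists_eq_add_of_le (Finset.le_sup (f := fun i : ℕ => kA (i : ℤ_[p])) hi)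
      rw [he, pow_add, mul_comm, mul_smul, hkA, smul_zero]⟩⟩
  refine ⟨Φ', (TelescopeK2InertiaDefect.mem_invariants_restrict_iff_of_trivial κ ρ φ hκ Φ').2 fun x h => ?_, ?_⟩
  · change ρ (φ h) (sec (Θ x)) = sec (Θ x)
    exact (hsec x).1 h
  · rw [C_smul]
    ext x
    change c • sec (Θ x) = Θ x
    exact (hsec x).2.2

end BigRep

end Summit.BirchSwinnertonDyer.BirchSwinnertonDyer.Theorems.TelescopeK2TwistedFixedAnnihilator

end
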